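import Summits.ValiantsHypothesis.ValiantsHypothesis.Theorems.KPlusLogSqLawStaticPathSilentFlipsSweep
import Summits.ValiantsHypothesis.ValiantsHypothesis.Theorems.KPlusLogSqLawStaticPathSilentCrossingsMore

/-!
# Route «KPlusLogSqLaw» — parametric max-weight independent set on a path: THEOREM A ON A WINDOW — #event crossings ≤ n + #silent crossings

HONEST FRAMING.  Helper toward the crux `WeakLifting` (item `stmt-ValiantsHypothesis-19561`, route `KPlusLogSqLaw`, cell `pub-symmetroid`,
seat val-sym-lift-p4 g24, 2026-08-29) on the line of its witness-plan stub `stub_tridiagonalSectorB` (tropical twin of the STATIC tridiagonal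
sector = parametric maximum-weight independent set on a path; located theory `HOME/val-sym-lift-p4/SILENT-FLIP-LAW.md`, THEOREM A).
Packaging of `card_events_le_add_card_silent_of_sweep` (`…StaticPathSilentFlipsSweep`) with the per-crossing dictionary of
`…StaticPathSilentCrossings(More)` in the window currency of `…StaticPathTropicalCount.sweep_count_eq`: for the prefix-sum arrangement of the
block `i+1, …, i+n` and a window `(θlo, θhi)` in general position (pairwise distinct crossing abscissae of non-parallel pairs, parallel pairs
distinct lines; crossings exactly at an end simply do not count, so no hypothesis on the ends is needed),

  `#{event crossings in the window} ≤ n + #{silent crossings in the window}`  (`card_eventCrossings_le_add_card_silentCrossings`),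

an EVENT crossing being a pair `p < q` crossing at `τ ∈ (θlo, θhi)` with `lab (q-1) τ = p` and `q` a right record at `τ` (as in `sweep_count_eq`,
whose `E` it is), a SILENT crossing one with `(lab (q-1) τ = p ∧ q not a right record at τ) ∨ (lab' (n-p-1) τ = n-q ∧ p not a left record at
τ)` — the crossings at which the record set changes (by exactly one index, `recordChange_unique`).  With `sweep_count_eq`: the tropical count of
the static path sector on a generic window is at most `n` plus the number of silent crossings.  Construction: sort ALL crossing abscissae of the
window (`Finset.orderEmbOfFin`), sample at the midpoints of consecutive cuts, read the sweep hypotheses and the two dictionaries off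
`stepHyps_of_cuts`, `eventStep_iff_eventTest`, `recordChange_iff_silentTest`.  Statements about a path DP; nothing here asserts anything about
`WeakLifting`, `TropicalB`, `KPlusLogSqLaw`, the stub in its window, `MatrixDescartes` (stmt-ValiantsHypothesis-18050) or `VP ≠ VNP`; the
ORDER QUESTION stays open (the silent crossings are not bounded here).
-/

set_option linter.dupNamespace false
set_option autoImplicit false

namespace Summit.ValiantsHypothesis.ValiantsHypothesis.Theorems.KPlusLogSqLaw

open Finset Classical

namespace StaticPathFold

noncomputable section

section Window

variable (w₁ w₀ : ℕ → ℝ)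

/-- **THEOREM A ON A WINDOW: #EVENT CROSSINGS ≤ n + #SILENT CROSSINGS** (`HOME/val-sym-lift-p4/SILENT-FLIP-LAW.md`). [folklore] -/
theorem card_eventCrossings_le_add_card_silentCrossings {i n : ℕ} {θlo θhi : ℝ} (hlohi : θlo < θhi)
    (hgen : ∀ p q p' q', p < q → q ≤ n → p' < q' → q' ≤ n → (p ≠ p' ∨ q ≠ q') →
      altA (shift i w₁) p ≠ altA (shift i w₁) q → altA (shift i w₁) p' ≠ altA (shift i w₁) q' →
      (altB (shift i w₀) q - altB (shift i w₀) p) / (altA (shift i w₁) p - altA (shift i w₁) q) ≠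
        (altB (shift i w₀) q' - altB (shift i w₀) p') / (altA (shift i w₁) p' - altA (shift i w₁) q'))
    (hpar : ∀ p q, p < q → q ≤ n → altA (shift i w₁) p = altA (shift i w₁) q → altB (shift i w₀) p ≠ altB (shift i w₀) q) :
    (((range (n + 1)) ×ˢ (range (n + 1))).filter (fun pq : ℕ × ℕ => pq.1 < pq.2 ∧
        altA (shift i w₁) pq.1 ≠ altA (shift i w₁) pq.2 ∧
        θlo < (altB (shift i w₀) pq.2 - altB (shift i w₀) pq.1) / (altA (shift i w₁) pq.1 - altA (shift i w₁) pq.2) ∧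
        (altB (shift i w₀) pq.2 - altB (shift i w₀) pq.1) / (altA (shift i w₁) pq.1 - altA (shift i w₁) pq.2) < θhi ∧
        (lab (altA (shift i w₁)) (altB (shift i w₀)) (pq.2 - 1)
            ((altB (shift i w₀) pq.2 - altB (shift i w₀) pq.1) / (altA (shift i w₁) pq.1 - altA (shift i w₁) pq.2)) = pq.1 ∧
          fold (altA (shift 0 (rev i n w₁))) (altB (shift 0 (rev i n w₀))) (n - pq.2)
              ((altB (shift i w₀) pq.2 - altB (shift i w₀) pq.1) / (altA (shift i w₁) pq.1 - altA (shift i w₁) pq.2)) =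
            L (altA (shift 0 (rev i n w₁))) (altB (shift 0 (rev i n w₀))) (n - pq.2)
              ((altB (shift i w₀) pq.2 - altB (shift i w₀) pq.1) / (altA (shift i w₁) pq.1 - altA (shift i w₁) pq.2))))).card ≤
      n + (((range (n + 1)) ×ˢ (range (n + 1))).filter (fun pq : ℕ × ℕ => pq.1 < pq.2 ∧
        altA (shift i w₁) pq.1 ≠ altA (shift i w₁) pq.2 ∧
        θlo < (altB (shift i w₀) pq.2 - altB (shift i w₀) pq.1) / (altA (shift i w₁) pq.1 - altA (shift i w₁) pq.2) ∧
        (altB (shift i w₀) pq.2 - altB (shift i w₀) pq.1) / (altA (shift i w₁) pq.1 - altA (shift i w₁) pq.2) < θhi ∧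
        ((lab (altA (shift i w₁)) (altB (shift i w₀)) (pq.2 - 1)
              ((altB (shift i w₀) pq.2 - altB (shift i w₀) pq.1) / (altA (shift i w₁) pq.1 - altA (shift i w₁) pq.2)) = pq.1 ∧
            ¬ fold (altA (shift 0 (rev i n w₁))) (altB (shift 0 (rev i n w₀))) (n - pq.2)
                ((altB (shift i w₀) pq.2 - altB (shift i w₀) pq.1) / (altA (shift i w₁) pq.1 - altA (shift i w₁) pq.2)) =
              L (altA (shift 0 (rev i n w₁))) (altB (shift 0 (rev i n w₀))) (n - pq.2)
                ((altB (shift i w₀) pq.2 - altB (shift i w₀) pq.1) / (altA (shift i w₁) pq.1 - altA (shift i w₁) pq.2))) ∨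
          (lab (altA (shift 0 (rev i n w₁))) (altB (shift 0 (rev i n w₀))) (n - pq.1 - 1)
              ((altB (shift i w₀) pq.2 - altB (shift i w₀) pq.1) / (altA (shift i w₁) pq.1 - altA (shift i w₁) pq.2)) = n - pq.2 ∧
            ¬ fold (altA (shift i w₁)) (altB (shift i w₀)) pq.1
                ((altB (shift i w₀) pq.2 - altB (shift i w₀) pq.1) / (altA (shift i w₁) pq.1 - altA (shift i w₁) pq.2)) =
              L (altA (shift i w₁)) (altB (shift i w₀)) pq.1
                ((altB (shift i w₀) pq.2 - altB (shift i w₀) pq.1) / (altA (shift i w₁) pq.1 - altA (shift i w₁) pq.2)))))).card := by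
  set A := altA (shift i w₁) with hAdef
  set B := altB (shift i w₀) with hBdef
  set A' := altA (shift 0 (rev i n w₁)) with hA'def
  set B' := altB (shift 0 (rev i n w₀)) with hB'def
  set τ : ℕ × ℕ → ℝ := fun pq => (B pq.2 - B pq.1) / (A pq.1 - A pq.2) with hτ
  -- event test, silent test, record predicates
  set evT : ℕ × ℕ → ℝ → Prop := fun pq t => lab A B (pq.2 - 1) t = pq.1 ∧ fold A' B' (n - pq.2) t = L A' B' (n - pq.2) t with hevT
  set silT : ℕ × ℕ → ℝ → Prop := fun pq t => (lab A B (pq.2 - 1) t = pq.1 ∧ ¬ fold A' B' (n - pq.2) t = L A' B' (n - pq.2) t) ∨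
    (lab A' B' (n - pq.1 - 1) t = n - pq.2 ∧ ¬ fold A B pq.1 t = L A B pq.1 t) with hsilT
  set P : Finset (ℕ × ℕ) := ((range (n + 1)) ×ˢ (range (n + 1))).filter (fun pq : ℕ × ℕ => pq.1 < pq.2 ∧ A pq.1 ≠ A pq.2 ∧
    θlo < τ pq ∧ τ pq < θhi) with hP
  set EV := ((range (n + 1)) ×ˢ (range (n + 1))).filter (fun pq : ℕ × ℕ => pq.1 < pq.2 ∧ A pq.1 ≠ A pq.2 ∧
    θlo < τ pq ∧ τ pq < θhi ∧ evT pq (τ pq)) with hEV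
  set SIL := ((range (n + 1)) ×ˢ (range (n + 1))).filter (fun pq : ℕ × ℕ => pq.1 < pq.2 ∧ A pq.1 ≠ A pq.2 ∧
    θlo < τ pq ∧ τ pq < θhi ∧ silT pq (τ pq)) with hSIL
  show EV.card ≤ n + SIL.card
  have hmemP : ∀ pq : ℕ × ℕ, pq ∈ P ↔ pq.1 < pq.2 ∧ pq.2 ≤ n ∧ A pq.1 ≠ A pq.2 ∧ θlo < τ pq ∧ τ pq < θhi := by
    intro pq
    rw [hP, mem_filter, mem_product, mem_range, mem_range]
    constructor
    · rintro ⟨⟨-, h2⟩, h3, h4, h5, h6⟩; exact ⟨h3, by omega, h4, h5, h6⟩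
    · rintro ⟨h3, h2, h4, h5, h6⟩; exact ⟨⟨by omega, by omega⟩, h3, h4, h5, h6⟩
  have hmemEV : ∀ pq : ℕ × ℕ, pq ∈ EV ↔ pq ∈ P ∧ evT pq (τ pq) := by
    intro pq
    rw [hmemP, hEV, mem_filter, mem_product, mem_range, mem_range]
    constructor
    · rintro ⟨⟨-, h2⟩, h3, h4, h5, h6, h7⟩; exact ⟨⟨h3, by omega, h4, h5, h6⟩, h7⟩
    · rintro ⟨⟨h3, h2, h4, h5, h6⟩, h7⟩; exact ⟨⟨by omega, by omega⟩, h3, h4, h5, h6, h7⟩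
  have hmemSIL : ∀ pq : ℕ × ℕ, pq ∈ SIL ↔ pq ∈ P ∧ silT pq (τ pq) := by
    intro pq
    rw [hmemP, hSIL, mem_filter, mem_product, mem_range, mem_range]
    constructor
    · rintro ⟨⟨-, h2⟩, h3, h4, h5, h6, h7⟩; exact ⟨⟨h3, by omega, h4, h5, h6⟩, h7⟩
    · rintro ⟨⟨h3, h2, h4, h5, h6⟩, h7⟩; exact ⟨⟨by omega, by omega⟩, h3, h4, h5, h6, h7⟩
  -- `τ` is injective on `P`
  have hτinj : ∀ pq ∈ P, ∀ pq' ∈ P, τ pq = τ pq' → pq = pq' := by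
    intro pq hpq pq' hpq' h
    obtain ⟨h1, h2, h3, -, -⟩ := (hmemP pq).mp hpq
    obtain ⟨h1', h2', h3', -, -⟩ := (hmemP pq').mp hpq'
    by_contra hne
    have hneq : pq.1 ≠ pq'.1 ∨ pq.2 ≠ pq'.2 := by
      by_contra hh; push Not at hh; exact hne (Prod.ext hh.1 hh.2)
    exact hgen pq.1 pq.2 pq'.1 pq'.2 h1 h2 h1' h2' hneq h3 h3' h
  -- sort all crossing abscissae of the window
  set m := P.card with hm
  set Evals : Finset ℝ := P.image τ with hEvals
  have hEcard : Evals.card = m := card_image_of_injOn (fun pq hpq pq' hpq' h => hτinj pq hpq pq' hpq' h)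
  obtain ⟨e, he_mono, he_mem, he_surj⟩ :
      ∃ e : Fin m → ℝ, StrictMono e ∧ (∀ j, e j ∈ Evals) ∧ (∀ v ∈ Evals, ∃ j, e j = v) := by
    refine ⟨fun j => Evals.orderEmbOfFin hEcard j, (Evals.orderEmbOfFin hEcard).strictMono, fun j => orderEmbOfFin_mem _ _ _,
      fun v hv => ?_⟩
    have hv' : v ∈ Set.range (Evals.orderEmbOfFin hEcard) := by rw [range_orderEmbOfFin]; exact hv
    exact hv'
  have hpqex : ∀ j, ∃ pq ∈ P, τ pq = e j := fun j => by
    have := he_mem j; rw [hEvals, mem_image] at this; exact this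
  choose pqF hpqFP hpqFτ using hpqex
  -- extend to `ℕ`: the crossing pair of step `k`, and the cuts `c`
  have hmpos_or : m = 0 ∨ 0 < m := Nat.eq_zero_or_pos m
  -- pairs as functions on ℕ
  set pqOf : ℕ → ℕ × ℕ := fun k => if h : k < m then pqF ⟨k, h⟩ else (0, 1) with hpqOf
  set x : ℕ → ℕ := fun k => (pqOf k).1 with hx
  set y : ℕ → ℕ := fun k => (pqOf k).2 with hy
  set c : ℕ → ℝ := fun k => if k = 0 then θlo else if h : k - 1 < m then e ⟨k - 1, h⟩ else θhi with hc
  set θ : ℕ → ℝ := fun k => (c k + c (k + 1)) / 2 with hθ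
  have hpqOf_lt : ∀ k (hk : k < m), pqOf k = pqF ⟨k, hk⟩ := fun k hk => by simp only [hpqOf, dif_pos hk]
  have hc0 : c 0 = θlo := by simp only [hc, if_pos rfl]
  have hcsucc : ∀ k (hk : k < m), c (k + 1) = e ⟨k, hk⟩ := fun k hk => by
    simp only [hc, Nat.add_one_ne_zero, if_false, Nat.add_sub_cancel, dif_pos hk]
  have hctop : c (m + 1) = θhi := by
    simp only [hc, Nat.add_one_ne_zero, if_false, Nat.add_sub_cancel, lt_irrefl, dif_neg, not_false_eq_true]
  have he_lo : ∀ j, θlo < e j := fun j => by rw [← hpqFτ j]; exact ((hmemP _).mp (hpqFP j)).2.2.2.1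
  have he_hi : ∀ j, e j < θhi := fun j => by rw [← hpqFτ j]; exact ((hmemP _).mp (hpqFP j)).2.2.2.2
  -- `c` is strictly increasing on `[0, m+1]`
  have hc_lt : ∀ k, k ≤ m → c k < c (k + 1) := by
    intro k hk
    rcases Nat.eq_zero_or_pos k with hk0 | hk0
    · subst hk0
      rw [hc0]
      rcases Nat.eq_zero_or_pos m with hm0 | hm0
      · have : c (0 + 1) = θhi := by rw [← hctop, hm0]
        rw [this]; exact hlohi
      · rw [hcsucc 0 hm0]; exact he_lo _
    · rcases Nat.lt_or_ge k m with hkm | hkm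
      · rw [show k = (k - 1) + 1 by omega, hcsucc (k - 1) (by omega), show k - 1 + 1 = k by omega, hcsucc k hkm]
        exact he_mono (Fin.lt_def.mpr (by simp; omega))
      · have hkm' : k = m := by omega
        have h1 : c (k + 1) = θhi := by rw [hkm']; exact hctop
        have h2 : c k = e ⟨k - 1, by omega⟩ := by
          have := hcsucc (k - 1) (by omega); rwa [show k - 1 + 1 = k by omega] at this
        rw [h1, h2]; exact he_hi _
  have hc_mono : ∀ a b, a < b → b ≤ m + 1 → c a < c b := by
    intro a b hab hb
    induction b with
    | zero => omega
    | succ b ih =>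
      rcases Nat.lt_or_ge a b with h | h
      · exact (ih h (by omega)).trans (hc_lt b (by omega))
      · have : a = b := by omega
        subst this; exact hc_lt a (by omega)
  -- every crossing abscissa of a non-parallel pair avoids the open gaps between consecutive cuts
  have hcut_all : ∀ k, k ≤ m → ∀ p q, p < q → q ≤ n → A p ≠ A q → (¬ (k < m ∧ (p, q) = pqOf k)) →
      τ (p, q) ≤ c k ∨ c (k + 1 + 1) ≤ τ (p, q) ∨ (k = m ∧ c (k + 1) ≤ τ (p, q)) := by
    intro k hk p q hpq hqn hApq hne
    by_cases hin : θlo < τ (p, q) ∧ τ (p, q) < θhi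
    · have hPpq : (p, q) ∈ P := (hmemP (p, q)).mpr ⟨hpq, hqn, hApq, hin.1, hin.2⟩
      obtain ⟨j, hj⟩ := he_surj (τ (p, q)) (by rw [hEvals]; exact mem_image_of_mem τ hPpq)
      have hjpq : pqF j = (p, q) := hτinj _ (hpqFP j) _ hPpq (by rw [hpqFτ j, hj])
      -- `τ (p,q) = c (j+1)`; `j ≠ k`
      have hτc : τ (p, q) = c (j.val + 1) := by rw [hcsucc j.val j.isLt]; exact hj.symm
      have hjk : (j : ℕ) ≠ k := by
        intro hjk
        apply hne
        have hkm : k < m := by rw [← hjk]; exact j.isLt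
        refine ⟨hkm, ?_⟩
        rw [hpqOf_lt k hkm, ← hjpq]
        congr 1; exact Fin.ext hjk
      rcases Nat.lt_or_gt_of_ne hjk with h | h
      · left
        rw [hτc]
        rcases Nat.lt_or_ge (j.val + 1) k with h2 | h2
        · exact (hc_mono _ _ h2 (by omega)).le
        · have : j.val + 1 = k := by omega
          rw [this]
      · right; left
        rw [hτc]
        rcases Nat.lt_or_ge (k + 1 + 1) (j.val + 1) with h2 | h2
        · exact (hc_mono _ _ h2 (by have := j.isLt; omega)).le
        · have : k + 1 + 1 = j.val + 1 := by omega
          rw [this]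
    · rw [not_and_or, not_lt, not_lt] at hin
      rcases hin with h | h
      · left
        have hck : θlo ≤ c k := by
          rcases Nat.eq_zero_or_pos k with h0 | h0
          · rw [h0, hc0]
          · rw [← hc0]; exact (hc_mono 0 k h0 (by omega)).le
        exact h.trans hck
      · rcases Nat.lt_or_ge k m with hkm | hkm
        · right; left; rw [← hctop] at h
          rcases Nat.lt_or_ge (k + 1 + 1) (m + 1) with h2 | h2
          · exact ((hc_mono _ _ h2 le_rfl).le).trans h
          · have : k + 1 + 1 = m + 1 := by omega
            rw [this]; exact h
        · right; right
          have hkm' : k = m := by omega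
          refine ⟨hkm', ?_⟩
          rw [hkm', hctop]; exact h
  -- per-step data for `k < m`: the pair, the cuts `c k < τ < c (k+2)`, and the cut hypothesis of the dictionaries
  have hstep : ∀ k, k < m → (x k < y k ∧ y k ≤ n ∧ A (x k) ≠ A (y k)) ∧ τ (x k, y k) = c (k + 1) ∧
      c k < τ (x k, y k) ∧ τ (x k, y k) < c (k + 1 + 1) ∧
      (∀ p q, p < q → q ≤ n → A p ≠ A q → (p ≠ x k ∨ q ≠ y k) →
        τ (p, q) ≤ c k ∨ c (k + 1 + 1) ≤ τ (p, q)) := by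
    intro k hk
    have hP' := hpqFP ⟨k, hk⟩
    have hpq : pqOf k = pqF ⟨k, hk⟩ := hpqOf_lt k hk
    obtain ⟨h1, h2, h3, -, -⟩ := (hmemP _).mp hP'
    have hxk : x k = (pqF ⟨k, hk⟩).1 := by simp only [hx, hpq]
    have hyk : y k = (pqF ⟨k, hk⟩).2 := by simp only [hy, hpq]
    have hxy : (x k, y k) = pqF ⟨k, hk⟩ := by rw [hxk, hyk]
    have hτk : τ (x k, y k) = c (k + 1) := by rw [hxy, hpqFτ, hcsucc k hk]
    refine ⟨⟨by rw [hxk, hyk]; exact h1, by rw [hyk]; exact h2, by rw [hxk, hyk]; exact h3⟩, hτk, ?_, ?_, ?_⟩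
    · rw [hτk]; exact hc_lt k hk.le
    · rw [hτk]; exact hc_mono _ _ (by omega) (by omega)
    · intro p q hpq' hqn hApq hne
      have hne' : ¬ (k < m ∧ (p, q) = pqOf k) := by
        rintro ⟨-, h⟩
        rw [← hxy] at *
        have : (p, q) = (x k, y k) := by rw [h]
        simp only [Prod.mk.injEq] at this
        rcases hne with h' | h'
        · exact h' this.1
        · exact h' this.2
      rcases hcut_all k hk.le p q hpq' hqn hApq hne' with h | h | ⟨h, -⟩
      · exact Or.inl h
      · exact Or.inr h
      · omega
  -- the degenerate case `m = 0`: no crossing in the window at all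
  rcases Nat.eq_zero_or_pos m with hm0 | hmpos
  · have hP0 : P = ∅ := Finset.card_eq_zero.mp (by rw [← hm]; exact hm0)
    have hEV0 : EV = ∅ := by
      apply Finset.eq_empty_of_forall_notMem
      intro pq hpq
      have := ((hmemEV pq).mp hpq).1
      rw [hP0] at this
      exact absurd this (Finset.notMem_empty _)
    rw [hEV0, card_empty]; exact Nat.zero_le _
  -- injectivity of the enumeration
  have hinjF : ∀ k k', k < m → k' < m → pqOf k = pqOf k' → k = k' := by
    intro k k' hk hk' h
    rw [hpqOf_lt k hk, hpqOf_lt k' hk'] at h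
    have he : e ⟨k, hk⟩ = e ⟨k', hk'⟩ := by rw [← hpqFτ, ← hpqFτ, h]
    have := he_mono.injective he
    simpa using this
  -- the sample points are the dictionaries' midpoints
  have hθu : ∀ k, k < m → θ k = (c k + τ (x k, y k)) / 2 := fun k hk => by
    show (c k + c (k + 1)) / 2 = _; rw [(hstep k hk).2.1]
  have hθs : ∀ k, k < m → θ (k + 1) = (τ (x k, y k) + c (k + 1 + 1)) / 2 := fun k hk => by
    show (c (k + 1) + c (k + 1 + 1)) / 2 = _; rw [(hstep k hk).2.1]
  -- the sweep hypotheses, read off `stepHyps_of_cuts`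
  have hxyS : ∀ k, k < m → x k < y k ∧ y k ≤ n := fun k hk => ⟨(hstep k hk).1.1, (hstep k hk).1.2.1⟩
  have hord : ∀ k, k < m → ∀ p q, p ≤ n → q ≤ n → ¬(p = x k ∧ q = y k) → ¬(p = y k ∧ q = x k) →
      (L A B p (θ k) < L A B q (θ k) ↔ L A B p (θ (k + 1)) < L A B q (θ (k + 1))) := by
    intro k hk
    obtain ⟨⟨h1, h2, h3⟩, -, hcm, hcp, hcut⟩ := hstep k hk
    rw [hθu k hk, hθs k hk]
    exact (stepHyps_of_cuts w₁ w₀ h1 h2 h3 hcm hcp hpar hcut).1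
  have hdis : ∀ k, k ≤ m → ∀ p q, p ≤ n → q ≤ n → p ≠ q → L A B p (θ k) ≠ L A B q (θ k) := by
    intro k hk
    rcases Nat.lt_or_ge k m with hkm | hkm
    · obtain ⟨⟨h1, h2, h3⟩, -, hcm, hcp, hcut⟩ := hstep k hkm
      rw [hθu k hkm]
      exact (stepHyps_of_cuts w₁ w₀ h1 h2 h3 hcm hcp hpar hcut).2.1
    · obtain ⟨k', hk'⟩ : ∃ k', k' + 1 = k := ⟨k - 1, by omega⟩
      have hk'm : k' < m := by omega
      obtain ⟨⟨h1, h2, h3⟩, -, hcm, hcp, hcut⟩ := hstep k' hk'm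
      rw [← hk', hθs k' hk'm]
      exact (stepHyps_of_cuts w₁ w₀ h1 h2 h3 hcm hcp hpar hcut).2.2.1
  have hadj : ∀ k, k < m → ∀ z, z ≤ n → z ≠ x k → z ≠ y k →
      (L A B z (θ k) < L A B (x k) (θ k) ↔ L A B z (θ k) < L A B (y k) (θ k)) := by
    intro k hk
    obtain ⟨⟨h1, h2, h3⟩, -, hcm, hcp, hcut⟩ := hstep k hk
    rw [hθu k hk]
    exact (stepHyps_of_cuts w₁ w₀ h1 h2 h3 hcm hcp hpar hcut).2.2.2.1
  have hflip : ∀ k, k < m → (L A B (x k) (θ k) < L A B (y k) (θ k) ↔ ¬ L A B (x k) (θ (k + 1)) < L A B (y k) (θ (k + 1))) := by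
    intro k hk
    obtain ⟨⟨h1, h2, h3⟩, -, hcm, hcp, hcut⟩ := hstep k hk
    rw [hθu k hk, hθs k hk]
    exact (stepHyps_of_cuts w₁ w₀ h1 h2 h3 hcm hcp hpar hcut).2.2.2.2
  have honce : ∀ k, k < m → ∀ k', k' < m → x k = x k' → y k = y k' → k = k' := by
    intro k hk k' hk' h1 h2
    exact hinjF k k' hk hk' (Prod.ext h1 h2)
  have hmain := card_events_le_add_card_silent_of_sweep w₁ w₀ i n m θ x y hxyS hord hdis hadj hflip honce
  -- the event crossings inject into the event steps
  set EvS := (range m).filter (fun k =>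
    fold A B (x k) (θ k) = L A B (x k) (θ k) ∧ fold A' B' (n - y k) (θ k) = L A' B' (n - y k) (θ k) ∧
      ∀ z, x k < z → z < y k → ¬ fold A B z (θ k) = L A B z (θ k) ∧ ¬ fold A' B' (n - z) (θ k) = L A' B' (n - z) (θ k)) with hEvS
  set MS := ((range m) ×ˢ (range (n + 1))).filter (fun kz : ℕ × ℕ =>
    ¬ ((fold A B kz.2 (θ kz.1) = L A B kz.2 (θ kz.1) ∨ fold A' B' (n - kz.2) (θ kz.1) = L A' B' (n - kz.2) (θ kz.1)) ↔
        (fold A B kz.2 (θ (kz.1 + 1)) = L A B kz.2 (θ (kz.1 + 1)) ∨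
          fold A' B' (n - kz.2) (θ (kz.1 + 1)) = L A' B' (n - kz.2) (θ (kz.1 + 1))))) with hMS
  change EvS.card ≤ n + MS.card at hmain
  -- index of a window pair
  have hidx : ∀ pq ∈ P, ∃ k, k < m ∧ pqOf k = pq := by
    intro pq hpq
    obtain ⟨j, hj⟩ := he_surj (τ pq) (by rw [hEvals]; exact mem_image_of_mem τ hpq)
    refine ⟨j.val, j.isLt, ?_⟩
    rw [hpqOf_lt j.val j.isLt]
    exact hτinj _ (hpqFP _) _ hpq (by rw [hpqFτ]; exact hj)
  choose! idx hidx_lt hidx_eq using hidx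
  have hEV_le : EV.card ≤ EvS.card := by
    refine Finset.card_le_card_of_injOn idx (fun pq hpq => ?_) (fun pq hpq pq' hpq' h => ?_)
    · have hpq : pq ∈ EV := mem_coe.mp hpq
      obtain ⟨hpqP, hev⟩ := (hmemEV pq).mp hpq
      have hk := hidx_lt pq hpqP
      have hkpq := hidx_eq pq hpqP
      obtain ⟨⟨h1, h2, h3⟩, -, hcm, hcp, hcut⟩ := hstep (idx pq) hk
      rw [mem_coe, hEvS, mem_filter, mem_range]
      refine ⟨hk, ?_⟩
      rw [hθu (idx pq) hk]
      have hxy : (x (idx pq), y (idx pq)) = pq := Prod.ext (by simp only [hx, hkpq]) (by simp only [hy, hkpq])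
      have hev' : evT (x (idx pq), y (idx pq)) (τ (x (idx pq), y (idx pq))) := by rw [hxy]; exact hev
      simp only [hevT] at hev'
      exact (eventStep_iff_eventTest w₁ w₀ h1 h2 h3 hcm hcp hpar hcut).mpr hev'
    · have hpq : pq ∈ EV := mem_coe.mp hpq
      have hpq' : pq' ∈ EV := mem_coe.mp hpq'
      have hP1 := ((hmemEV pq).mp hpq).1
      have hP2 := ((hmemEV pq').mp hpq').1
      rw [← hidx_eq pq hP1, ← hidx_eq pq' hP2, h]
  -- the record-change steps inject into the silent crossings
  have hMS_le : MS.card ≤ SIL.card := by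
    refine Finset.card_le_card_of_injOn (fun kz => pqOf kz.1) (fun kz hkz => ?_) (fun kz hkz kz' hkz' h => ?_)
    · have hkz : kz ∈ MS := mem_coe.mp hkz
      rw [hMS, mem_filter, mem_product, mem_range, mem_range] at hkz
      obtain ⟨⟨hk, hz⟩, hch⟩ := hkz
      obtain ⟨⟨h1, h2, h3⟩, -, hcm, hcp, hcut⟩ := hstep kz.1 hk
      rw [mem_coe, hmemSIL]
      have hpqP : pqOf kz.1 ∈ P := by rw [hpqOf_lt kz.1 hk]; exact hpqFP _
      refine ⟨hpqP, ?_⟩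
      have hsil := (recordChange_iff_silentTest w₁ w₀ h1 h2 h3 hcm hcp hpar hcut).mp
        ⟨kz.2, by omega, by rw [← hθu kz.1 hk, ← hθs kz.1 hk]; exact hch⟩
      exact hsil
    · have hkz : kz ∈ MS := mem_coe.mp hkz
      have hkz' : kz' ∈ MS := mem_coe.mp hkz'
      rw [hMS, mem_filter, mem_product, mem_range, mem_range] at hkz hkz'
      obtain ⟨⟨hk, hz⟩, hch⟩ := hkz
      obtain ⟨⟨hk', hz'⟩, hch'⟩ := hkz'
      have hkk : kz.1 = kz'.1 := hinjF _ _ hk hk' h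
      obtain ⟨⟨h1, h2, h3⟩, -, hcm, hcp, hcut⟩ := hstep kz.1 hk
      have hzz : kz.2 = kz'.2 := by
        refine recordChange_unique w₁ w₀ h1 h2 h3 hcm hcp hpar hcut (by omega) (by omega)
          (by rw [← hθu kz.1 hk, ← hθs kz.1 hk]; exact hch) ?_
        rw [← hθu kz.1 hk, ← hθs kz.1 hk, hkk]; exact hch'
      exact Prod.ext hkk hzz
  omega

end Window

end

end StaticPathFold

end Summit.ValiantsHypothesis.ValiantsHypothesis.Theorems.KPlusLogSqLaw
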